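import Summits.RiemannHypothesis.RiemannHypothesis.Theses.LiDirichletEcho
import Literature.NumberTheory.LFunctions.WeilCriterionConverseDirichlet
import Literature.NumberTheory.LFunctions.CharZeroSum
import HarnessLib

/-!
# RiemannHypothesis / LiDirichletEcho — support `CharWindowConj`: the conjugation split of the both-signs trace
# (RH-FREE, GRH-FREE)

RH-FREE · GRH-FREE [rh-li-eng g5, acting as prover on the unstaffed route].  Route `Theses/LiDirichletEcho.lean` (rung
«Li PRIME-ECHO LAW FOR DIRICHLET CHARACTERS» `LiTheory.LiZeroWindowEchoDirichlet`, L-P(P1χ); cell `pub/rh-li`, dossier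
`theory/route/p5`), support item `CharWindowConj` (stmt-RiemannHypothesis-19404; the second skeleton statement behind the
route Assembly): for `χ ≠ 1`, `0 ≤ T₁ ≤ T₂`,

  `charZeroTraceWindow χ n T₁ T₂ = charUpperTraceWindow χ n T₁ T₂ + charUpperTraceWindow χ⁻¹ n T₁ T₂`.

Proof: the box `lfunctionZeroBox χ T` splits into the zeros with `Im ρ > 0`, `Im ρ < 0` and `Im ρ = 0`; the last part
does not depend on `T ≥ 0` (real zeros in `(0, 1)`, if any, sit in every box) and cancels in the window; complex
conjugation is a bijection from the zeros of `L(s, χ)` with `Im ρ < 0` onto the zeros of `L(s, χ̄) = L(s, χ⁻¹)` with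
`Im ρ > 0` (`conj L(s̄, χ) = L(s, χ⁻¹)`, tree `DirichletZFR.conj_LFunction_conj`) preserving multiplicities
(`WeilConverseChar.zeroOrder_inv_conj`), and `(1 − 1/ρ̄)ⁿ = conj (1 − 1/ρ)ⁿ` has the same real part.  Pure bookkeeping about
where the zeros are listed; nothing here bears on the truth of RH or GRH.
-/

noncomputable section

-- D-0017: `Summit.<S>.<S>.…` is the designed namespace of a single-problem summit.
set_option linter.dupNamespace false

open Complex Set
open scoped ComplexConjugate

namespace Summit.RiemannHypothesis.RiemannHypothesis.Theorems.LiTheory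

open Literature.NumberTheory.LFunctions Literature.NumberTheory.LFunctions.ExplicitPsiChar

namespace WindowConjChar

variable {q : ℕ} [NeZero q] {χ : DirichletCharacter ℂ q}

/-- The summand `m_χ(ρ) (1 − 1/ρ)ⁿ`. -/
def term (χ : DirichletCharacter ℂ q) (n : ℕ) (ρ : ℂ) : ℂ := (DirichletDisc.zeroOrder χ ρ : ℂ) * (1 - 1 / ρ) ^ n

/-- `L(ρ̄, χ⁻¹) = 0 ↔ L(ρ, χ) = 0` (`χ ≠ 1`). -/
theorem LFunction_inv_conj_eq_zero_iff (hχ : χ ≠ 1) (ρ : ℂ) : χ⁻¹.LFunction (conj ρ) = 0 ↔ χ.LFunction ρ = 0 := by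
  rw [← DirichletZFR.conj_LFunction_conj χ hχ (conj ρ), Complex.conj_conj, map_eq_zero]

/-- The summand transforms under conjugation: `term χ n (conj ρ) = conj (term χ⁻¹ n ρ)`. -/
theorem term_conj (hχ : χ ≠ 1) (n : ℕ) (ρ : ℂ) : term χ n (conj ρ) = conj (term χ⁻¹ n ρ) := by
  unfold term
  have hm : DirichletDisc.zeroOrder χ (conj ρ) = DirichletDisc.zeroOrder χ⁻¹ ρ := by
    have h := WeilConverseChar.zeroOrder_inv_conj hχ (conj ρ)
    rw [Complex.conj_conj] at h
    exact h.symm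
  rw [hm, map_mul, map_pow, map_sub, map_one, map_div₀, map_one, Complex.conj_natCast]

/-- The zeros of `L(s, χ)` with `Im ρ < 0` in the box are the conjugates of the zeros of `L(s, χ⁻¹)` with `Im ρ > 0`. -/
theorem bijOn_conj (hχ : χ ≠ 1) (T : ℝ) :
    BijOn (fun ρ : ℂ ↦ conj ρ) (lfunctionZeroBox χ T ∩ {ρ : ℂ | ρ.im < 0})
      (lfunctionZeroBox χ⁻¹ T ∩ {ρ : ℂ | 0 < ρ.im}) := by
  refine ⟨?_, ?_, ?_⟩
  · rintro ρ ⟨hρ, him⟩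
    obtain ⟨hL, h0, h1, habs⟩ := mem_lfunctionZeroBox.1 hρ
    refine ⟨mem_lfunctionZeroBox.2 ⟨(LFunction_inv_conj_eq_zero_iff hχ ρ).2 hL, by simpa using h0, by simpa using h1,
      by simpa using habs⟩, ?_⟩
    show 0 < (conj ρ).im
    rw [Complex.conj_im]; exact neg_pos.2 him
  · exact fun ρ _ ρ' _ h ↦ (starRingEnd ℂ).injective h
  · rintro ρ' ⟨hρ', him⟩
    obtain ⟨hL, h0, h1, habs⟩ := mem_lfunctionZeroBox.1 hρ'
    refine ⟨conj ρ', ⟨mem_lfunctionZeroBox.2 ⟨?_, by simpa using h0, by simpa using h1, by simpa using habs⟩, ?_⟩,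
      Complex.conj_conj ρ'⟩
    · rw [← LFunction_inv_conj_eq_zero_iff hχ, Complex.conj_conj]; exact hL
    · show (conj ρ').im < 0
      rw [Complex.conj_im]; exact neg_neg_of_pos him

/-- **The both-signs trace splits**: for `χ ≠ 1` and `T ≥ 0`,
`Z_χ(T) = U_χ(T) + U_{χ⁻¹}(T) + Re Σ_{real zeros} m_χ(ρ)(1 − 1/ρ)ⁿ` (the last sum is independent of `T`). -/
theorem charZeroTrace_split (hχ : χ ≠ 1) (n : ℕ) {T : ℝ} (hT : 0 ≤ T) :
    charZeroTrace χ n T = charUpperZeroTrace χ n T + charUpperZeroTrace χ⁻¹ n T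
      + (∑ᶠ ρ ∈ {ρ : ℂ | ρ ∈ charNontrivialZeros χ ∧ ρ.im = 0}, term χ n ρ).re := by
  have hχ' : χ⁻¹ ≠ 1 := inv_ne_one.mpr hχ
  set S : Set ℂ := lfunctionZeroBox χ T with hS
  set Sp : Set ℂ := S ∩ {ρ : ℂ | 0 < ρ.im} with hSp
  set Sm : Set ℂ := S ∩ {ρ : ℂ | ρ.im < 0} with hSm
  set S0 : Set ℂ := {ρ : ℂ | ρ ∈ charNontrivialZeros χ ∧ ρ.im = 0} with hS0
  set Sp' : Set ℂ := lfunctionZeroBox χ⁻¹ T ∩ {ρ : ℂ | 0 < ρ.im} with hSp'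
  have hSf : S.Finite := lfunctionZeroBox_finite hχ T
  have hSpf : Sp.Finite := hSf.subset inter_subset_left
  have hSmf : Sm.Finite := hSf.subset inter_subset_left
  have hS0S : S0 ⊆ S := by
    rintro ρ ⟨hρ, him⟩
    obtain ⟨hL, h0, h1⟩ := mem_charNontrivialZeros.1 hρ
    exact mem_lfunctionZeroBox.2 ⟨hL, h0, h1, by rw [him, abs_zero]; exact hT⟩
  have hS0f : S0.Finite := hSf.subset hS0S
  -- `S = (Sp ∪ Sm) ∪ S0`
  have hunion : S = (Sp ∪ Sm) ∪ S0 := by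
    ext ρ
    simp only [hSp, hSm, hS0, mem_union, mem_inter_iff, mem_setOf_eq]
    constructor
    · intro hρ
      rcases lt_trichotomy 0 ρ.im with h | h | h
      · exact Or.inl (Or.inl ⟨hρ, h⟩)
      · obtain ⟨hL, h0, h1, -⟩ := mem_lfunctionZeroBox.1 hρ
        exact Or.inr ⟨mem_charNontrivialZeros.2 ⟨hL, h0, h1⟩, h.symm⟩
      · exact Or.inl (Or.inr ⟨hρ, h⟩)
    · rintro ((⟨hρ, -⟩ | ⟨hρ, -⟩) | h0)
      · exact hρ
      · exact hρ
      · exact hS0S h0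
  have hd1 : Disjoint Sp Sm := by
    rw [Set.disjoint_left]
    rintro ρ ⟨-, h1⟩ ⟨-, h2⟩
    have h1' : 0 < ρ.im := h1
    have h2' : ρ.im < 0 := h2
    exact lt_asymm h1' h2'
  have hd2 : Disjoint (Sp ∪ Sm) S0 := by
    rw [Set.disjoint_left]
    rintro ρ (⟨-, h1⟩ | ⟨-, h1⟩) ⟨-, h2⟩
    · have h1' : 0 < ρ.im := h1
      exact h1'.ne' h2
    · have h1' : ρ.im < 0 := h1
      exact h1'.ne h2
  -- the `Im < 0` part is the conjugate of the upper part of `χ⁻¹`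
  have hminus : ∑ᶠ ρ ∈ Sm, term χ n ρ = conj (∑ᶠ ρ ∈ Sp', term χ⁻¹ n ρ) := by
    have hSp'f : Sp'.Finite := (lfunctionZeroBox_finite hχ' T).subset inter_subset_left
    rw [finsum_mem_eq_of_bijOn (fun ρ : ℂ ↦ conj ρ) (bijOn_conj hχ T) (fun ρ _ ↦ ?_)]
    · exact (AddMonoidHom.map_finsum_mem (fun ρ ↦ term χ⁻¹ n ρ) (starRingEnd ℂ).toAddMonoidHom hSp'f).symm
    · -- `term χ n ρ = conj (term χ⁻¹ n (conj ρ))`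
      show term χ n ρ = conj (term χ⁻¹ n (conj ρ))
      have := term_conj hχ n (conj ρ)
      rw [Complex.conj_conj] at this
      exact this
  unfold charZeroTrace charUpperZeroTrace
  change (∑ᶠ ρ ∈ S, term χ n ρ).re = (∑ᶠ ρ ∈ Sp, term χ n ρ).re + (∑ᶠ ρ ∈ Sp', term χ⁻¹ n ρ).re
    + (∑ᶠ ρ ∈ S0, term χ n ρ).re
  rw [hunion, finsum_mem_union hd2 (hSpf.union hSmf) hS0f, finsum_mem_union hd1 hSpf hSmf, hminus,
    Complex.add_re, Complex.add_re, Complex.conj_re]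

end WindowConjChar

open WindowConjChar in
/-- **Support `CharWindowConj` of route `LiDirichletEcho`** (stmt-RiemannHypothesis-19404; RH-FREE, GRH-FREE): for `χ ≠ 1`
and `0 ≤ T₁ ≤ T₂`, `charZeroTraceWindow χ n T₁ T₂ = charUpperTraceWindow χ n T₁ T₂ + charUpperTraceWindow χ⁻¹ n T₁ T₂`. -/
theorem charWindowConj_eq {q : ℕ} [NeZero q] (χ : DirichletCharacter ℂ q) (hχ : χ ≠ 1) (n : ℕ) {T₁ T₂ : ℝ}
    (hT₁ : 0 ≤ T₁) (hT : T₁ ≤ T₂) :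
    charZeroTraceWindow χ n T₁ T₂ = charUpperTraceWindow χ n T₁ T₂ + charUpperTraceWindow χ⁻¹ n T₁ T₂ := by
  unfold charZeroTraceWindow charUpperTraceWindow
  rw [charZeroTrace_split hχ n hT₁, charZeroTrace_split hχ n (hT₁.trans hT)]
  ring

/-- **Item `CharWindowConj` of route `LiDirichletEcho`** (stmt-RiemannHypothesis-19404), closed BY NAME. -/
theorem charWindowConj_proof :
    Summit.RiemannHypothesis.RiemannHypothesis.Theses.LiDirichletEcho.CharWindowConj :=
  fun _ _ χ hχ n _ _ hT₁ hT ↦ charWindowConj_eq χ hχ n hT₁ hT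

end Summit.RiemannHypothesis.RiemannHypothesis.Theorems.LiTheory

end
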